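import Literature.Probability.RandomPlanarGeometry.RestrictionHulls
import Literature.Probability.RandomPlanarGeometry.BrownianLoopMeasure
import HarnessLib

/-!
# The loop-measure form of the restriction martingale: `E[1{γ ⊂ D} Ψ_{∞,D}(γ)^{c/2}] = Φ'_D(0)^b` (Lawler 2009, Prop. 2.1)

Topic `Literature/Probability/RandomPlanarGeometry`; statement-only companion of
`BrownianLoopMeasure.lean` (whose module docstring announces this file: "the SLE restriction
formula with loop masses ([Lawler2009] Prop. 2.1) is `SLELoopRestriction`") and of
`RestrictionHulls.lean` (`sle_restriction_eightThirds`, [LSW] Thm. 6.1, the case `κ = 8/3`,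
`c = 0` of the present fact).

Source: G. F. Lawler, *Partition functions, loop measure, and versions of SLE*, J. Stat. Phys.
**134** (2009) 813–837, doi:10.1007/s10955-009-9704-6 (**[Lawler2009]**), §2.2 (pp. 5–7 of the
journal offprint). Printed text (p. 5): "Suppose `D ⊂ ℍ` is a simply connected subdomain with
`ℍ∖D` bounded and `dist(0, ℍ∖D) > 0`. Let `Φ_D` be the unique conformal transformation of `ℍ ∖ D`
[sic; of `D`] onto `ℍ` with `Φ_D(z) = z + o(1)` as `z → ∞`. If `γ(t)` is an SLE_κ curve from `0`
to infinity …"; (p. 6) "We write `Λ(K₁, K₂; D)` for the measure of the set of loops in `D` that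
intersect both `K₁` and `K₂` … If we define `Ψ_{t,D}(γ) = Ψ(γ_t, ℍ ∖ D; ℍ) := exp{Λ(γ_t, ℍ ∖ D; ℍ)}`,
and let `H_D(x, ∞) = Φ'_D(x)^b`, then the local martingale becomes `M_t = Ψ_{t,D}(γ)^{c/2} H_{D_t}(U_t, ∞)`
(4) … **Proposition 2.1.** For `κ ≤ 4`, if `M_∞ = lim_{t → ∞} M_t = 1{γ ⊂ D} Ψ_{∞,D}(γ)^{c/2}`, then
`E[M_∞] = M_0 = Φ'_D(0)^b`. This was proved in [7] [= LSW 2003] for `κ ≤ 8/3` (for which `c ≤ 0`)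
using a more complicated argument. For `8/3 < κ ≤ 4` (`c > 0`), `M_t` is not bounded and the
Girsanov argument is the only way I know how to prove this." Parameters (p. 3, (1)):
`b = (6 − κ)/(2κ)` (boundary scaling exponent), `c = (8 − 3κ)(κ − 6)/(2κ)` (central charge);
"`γ ⊂ D`" means `γ(0, ∞) ⊂ D` (p. 5). Consequence printed as eq. (5) (p. 8, the **boundary
perturbation / generalised restriction rule**): "If `κ ≤ 4`, `D₁ ⊂ D`, and `∂D₁ = ∂D` near smooth
boundary points `z, w`, `dμ_{D₁}(z, w)/dμ_D(z, w) (γ) = 1{γ ⊂ D₁} Ψ(γ, D ∖ D₁; D)^{c/2}`" for the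
partition-function-normalised SLE_κ measures `μ_D(z, w) = H_D(z, w) μ^#_D(z, w)` — not vendored
here (it needs the non-probability measures `μ_D(z, w)` of §2.3).

## The Lean statement (`Lawler2009_prop21`)

Exactly in the frame of `sle_restriction_eightThirds`: the SLE_κ trace `γ = sleTrace κ ω` on the
canonical space `(ℝ≥0 → ℝ, preWienerMeasure)`; the complement `ℍ ∖ D` is a hull `A ∈ 𝒬*`
(`IsStarHull A`: bounded, bounded away from `0`, `ℍ ∖ A` simply connected — a sub-case of the
printed hypothesis "`ℍ ∖ D` bounded, `dist(0, ℍ ∖ D) > 0`, `D` simply connected"; `D = ℍ ∖ A`),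
`Φ_D = Φ_A` its restriction map (`IsRestrictionMap A Φ`) and `Φ'_D(0) = d` any restriction
derivative (`HasRestrictionDeriv A Φ d`); `Λ(γ, ℍ ∖ D; ℍ) = loopMass ℍ (range γ) A`, the Brownian
loop mass of `BrownianLoopMeasure.lean` ([LW04] normalisation `dA ⊗ dt/(2πt²) ⊗ bridge`, the one of
[Lawler2009] §4: "the natural random walk loop measure approaches the Brownian loop measure");
the event `{γ(0, ∞) ⊂ D}` is written `{range γ ∩ A = ∅}` as in Thm. 6.1 (for `κ ≤ 4` the trace is
a simple curve in `ℍ ∪ {0}` and `0 ∉ A`, so the two agree a.s.). The expectation of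
`1{γ ⊂ D} e^{(c/2) Λ}` is a set-`lintegral` of `ENNReal.ofReal (exp ((c/2) · Λ.toReal))`; on the
event, `Λ(γ, A; ℍ) < ∞` (bounded `A`, closed unbounded `γ[0, ∞)` at positive distance, `∂ℍ`
nonpolar: `loopMass_lt_top`), so the `toReal` junk value is not met. At `κ = 2` (the case used by
route CriticalPhenomena/SAWLoopAvoidanceChaos): `b = 1`, `c = −2`, i.e.
`E[1{γ ∩ A = ∅} exp(−Λ(γ, A; ℍ))] = Φ'_A(0)` — the restriction DEFECT of SLE₂ is the Brownian-loop
void weight; this is the printed `c = −2` ingredient of crux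
`Summit.CriticalPhenomena.SAWScalingLimit.Theses.SAWLoopAvoidanceChaos.ChaosRestriction`
(stmt-CriticalPhenomena-4524), which it does NOT close (the crux is about the `ε → 0` limit of a
route-posited regularised law). At `κ = 8/3`: `c = 0`, `b = 5/8`, and the statement is literally
[LSW] Thm. 6.1 (`Lawler2009_prop21.sle_restriction_eightThirds`, proved below as a sanity check of
the constants).

## References

* [Lawler2009] G. F. Lawler, *Partition functions, loop measure, and versions of SLE*, J. Stat.
  Phys. 134 (2009) 813–837, §2.2 Prop. 2.1, eqs. (4)–(5).
* [LSW] G. F. Lawler, O. Schramm, W. Werner, *Conformal restriction: the chordal case*, JAMS 16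
  (2003), Thm. 6.1, Thm. 6.5. [LawlerSchrammWerner2003Restriction]
* [LW04] G. F. Lawler, W. Werner, *The Brownian loop soup*, PTRF 128 (2004). [LawlerWerner2004]
-/

noncomputable section

open Set Filter Topology MeasureTheory
open UpperHalfPlane (upperHalfPlaneSet)
open scoped NNReal ENNReal

namespace Literature.Probability.RandomPlanarGeometry

/-- NAMED FACT — **[Lawler2009] Proposition 2.1** (loop-measure form of the SLE_κ restriction
martingale, `κ ≤ 4`). "For `κ ≤ 4`, if `M_∞ = lim_{t→∞} M_t = 1{γ ⊂ D} Ψ_{∞,D}(γ)^{c/2}`, then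
`E[M_∞] = M_0 = Φ'_D(0)^b`", where `Ψ_{∞,D}(γ) = exp{Λ(γ, ℍ ∖ D; ℍ)}` is the exponential of the
Brownian loop mass of the loops in `ℍ` meeting both `γ[0, ∞)` and `ℍ ∖ D`, `b = (6 − κ)/(2κ)`,
`c = (8 − 3κ)(κ − 6)/(2κ)`. Stated for `D = ℍ ∖ A`, `A ∈ 𝒬*` (`IsStarHull`), restriction map `Φ`
and restriction derivative `d = Φ'_A(0)`, SLE_κ trace `sleTrace κ ω` under `preWienerMeasure`,
`Λ = loopMass ℍ (range γ) A` (see the module docstring for the dictionary and the `toReal`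
convention). At `κ = 2`: `E[1{γ ∩ A = ∅} e^{−Λ(γ, A; ℍ)}] = Φ'_A(0)` (printed `c = −2` ingredient of
crux `ChaosRestriction` of route CriticalPhenomena/SAWLoopAvoidanceChaos, stmt-CriticalPhenomena-4524).
[cite: Lawler2009, Prop. 2.1 (§2.2, eq. (4))] -/
def Lawler2009_prop21 : Prop :=
  ∀ {κ : ℝ≥0}, 0 < κ → (κ : ℝ) ≤ 4 →
    ∀ {A : Set ℂ}, IsStarHull A →
      ∀ {Φ : ConformalEquiv (upperHalfPlaneSet \ A) upperHalfPlaneSet}, IsRestrictionMap A Φ →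
        ∀ {d : ℝ}, HasRestrictionDeriv A Φ d →
          ∫⁻ ω in {ω | Disjoint (range (sleTrace κ ω)) A},
              ENNReal.ofReal (Real.exp
                ((8 - 3 * (κ : ℝ)) * ((κ : ℝ) - 6) / (2 * (κ : ℝ)) / 2 *
                  (loopMass upperHalfPlaneSet (range (sleTrace κ ω)) A).toReal))
            ∂Process.preWienerMeasure =
            ENNReal.ofReal (d ^ ((6 - (κ : ℝ)) / (2 * (κ : ℝ))))

/-- Sanity check of the constants: at `κ = 8/3` the central charge vanishes (`c = 0`), the weight
is `1`, `b = 5/8`, and Prop. 2.1 is [LSW] Thm. 6.1, `P[γ[0, ∞) ∩ A = ∅] = Φ'_A(0)^{5/8}`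
(`sle_restriction_eightThirds`). [cite: Lawler2009, Prop. 2.1 ("This was proved in [7] for κ ≤ 8/3")] -/
theorem Lawler2009_prop21.sle_restriction_eightThirds (h : Lawler2009_prop21) :
    Literature.Probability.RandomPlanarGeometry.sle_restriction_eightThirds := by
  intro A hA Φ hΦ d hd
  have h83 : (0 : ℝ≥0) < (8 : ℝ≥0) / 3 := by positivity
  have h83' : (((8 : ℝ≥0) / 3 : ℝ≥0) : ℝ) ≤ 4 := by push_cast; norm_num
  have key := h h83 h83' hA hΦ hd
  have hc : (8 - 3 * (((8 : ℝ≥0) / 3 : ℝ≥0) : ℝ)) = 0 := by push_cast; ring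
  have hb : (6 - (((8 : ℝ≥0) / 3 : ℝ≥0) : ℝ)) / (2 * (((8 : ℝ≥0) / 3 : ℝ≥0) : ℝ)) = (5 : ℝ) / 8 := by
    push_cast; norm_num
  simp only [hc, zero_mul, zero_div, Real.exp_zero, ENNReal.ofReal_one, lintegral_one,
    Measure.restrict_apply MeasurableSet.univ, univ_inter, hb] at key
  exact key

end Literature.Probability.RandomPlanarGeometry

end
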